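import Summits.QuantumFields.BalabanUV.T4Continuum.Support.NE7CornerGaugeStep
import HarnessLib

/-!
# T⁴ programme, row NE7 — (154e) THE C² CORNER-GAUGE INTERPOLATION `exists_smooth_corner_gauge`: unitary coarse data
# `v` on the corners `M•ℤ^d` with nearest-neighbour oscillation `ω` extend to a unitary fine-lattice map `w` with
# `w(M•z) = v z`, first differences `≤ 8ω∕M`, second differences `≤ 165ω∕M²` (`NE7CornerGaugeInterpolation`)

Cell `pub-balaban`, lineage `t4-ne7-p2` (CRUX PROVER NE7 #2), gen 86; fifth and last file of the kernel chain (154) = road (β′)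
of PRICING-NE7 §419 ∕ `g85/HFLATTOP-MEMO.md` §4 (the frame step that strikes THE END's normalisation `hflatTop` by re-gauging
B8's representative with a C² interpolant of the inverse corner values of its gauge).  THE CONSTRUCTION: starting from the
pullback `g₀ y = v ⌊y∕M⌋`, the directions `j = 0, …, d−1` are filled one at a time by the smoothstep-geodesic step of (154d),
`g_{j+1} y = geo (φ(res M y j ∕ M)) (g_j ⌊y⌋_j) (g_j (⌊y⌋_j + M e_j))`, `φ(t) = 3t² − 2t³`; no definition is introduced (the
iteration runs inside an existential induction on `j`, §1), and `w := g_d`.  THE ESTIMATES (§1, by (154d) with the invariant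
`Ω_j ≤ ω(1 + 30ωj)`, `λ_j ≤ (7ω∕M)(1 + 30ωj)`, `σ_j ≤ (110ω∕M²)(1 + 150ωj)` under `300·d·ω ≤ 1`): the coarse oscillation does
not grow beyond `1.1ω` (SHARP endpoint bounds of (154b)), first differences stay `≤ 7.7ω∕M`, second differences `≤ 165ω∕M²`.
§2 THE THEOREM `exists_smooth_corner_gauge`: for unitary `N`-periodic `v : ℤ^d → U(𝔸)` with `‖v(z + e_i) − v z‖ ≤ ω`,
`300·d·ω ≤ 1`, `M ≥ 1`: `∃ w`, unitary, `M·N`-periodic, `w (M•z) = v z`, `‖w(y+e_μ) − w y‖ ≤ 8ω∕M`,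
`‖w(y+e_μ+e_τ) − w(y+e_τ) − w(y+e_μ) + w y‖ ≤ 165ω∕M²` for all `y, μ, τ`.
USE (the OWNER's ∕ THE END's, not done here): with `v z := u₀(Mz)⁻¹` for B8's gauge `u₀` of the representative over a
flat-top background, `u := w·u₀`-type re-gauging makes `u|_{corners}` constant, hence `cavgIter L (k+1) (U^u) = 1`
(`NE3CpushGaugeCovariance.cavgIter_gaugeAct`, (153) §5), at the price `α̂ ↦ α̂ + 8ω`, `α̂₁ ↦ α̂₁ + 165ω + O(ωα̂)` in the
currencies of F54 — the log-chart bookkeeping of the re-gauged link variables is a separate (S-sized) file.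

HONEST FRAMING (page 1): a [folklore] lattice-interpolation lemma (C² manifold-valued interpolation of lattice data; the
smoothstep reparametrisation makes the block-to-block generator changes invisible to second differences), composed BY NAME
over (154a–d) and the tree's `UnitaryGeodesic` ∕ `SmoothRefineBlocks`; constants `8`, `165`, `300` are the files' (not
optimised; the sharp values are `≈ 3∕2` and `≈ 6`).  Nothing of Bałaban's is used or claimed; `hflatTop` is NOT discharged in
THIS file (no gauge field appears here); (APE) NOT proved; NE7 NOT PRINTED ∕ NOT PROVED; spine 0∕9; finite T⁴ rung (B)+1 —
NOT infinite volume, NOT mass gap, NOT Clay.  No `sorry`.  PLACEMENT: our lemma, under `Summits/QuantumFields/BalabanUV/`.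
Continuum YM on T⁴ ⇐ BetaPertH ∧ nine spine estimates (0/9 proved); BetaPertH ⇐ (D1) ∧ (D4) ∧ CAP+tail; G-an2-4 gates asym, D1 and NE2/3/4.
-/

set_option autoImplicit false

open NormedSpace

namespace Summit.QuantumFields.BalabanUV.T4Continuum.NE7CornerGaugeInterpolation

open Literature.MathematicalPhysics.QuantumFieldTheory.Balaban1983to89
open MatrixLog B7Prop1Explicit B7Prop2Explicit UnitaryRootInterpolation UnitaryGeodesic NE7ExpLogSecondOrder
  NE7GeodesicSecondOrder NE7GeodesicParameter NE7CornerGaugeStep SmoothRefineBlocks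

noncomputable section

variable {𝔸 : Type*} [CStarAlgebra 𝔸] [Nontrivial 𝔸] {d M : ℕ}

/-! ## §1 The iteration over the directions -/

/-- **The iteration** (directions `< k` filled): from the pullback `v ∘ blk M` (`k = 0`), `k` steps of (154d) produce a unitary,
`M·N`-periodic map with the corner values of `v`, piecewise constant with coarse oscillation `≤ ω(1 + 30ωk)` in the directions
`≥ k`, first differences `≤ (7ω∕M)(1 + 30ωk)` and second differences `≤ (110ω∕M²)(1 + 150ωk)` in the directions `< k`
(`300·d·ω ≤ 1`). [folklore] -/
theorem iterate (hM : 1 ≤ M) (N : ℕ) {v : Site d → 𝔸ˣ} (hvU : ∀ z, v z ∈ unitaryUnits 𝔸)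
    (hvP : ∀ (z : Site d) (i : Fin d), v (z + (N : ℤ) • e i) = v z) {ω : ℝ}
    (hvω : ∀ (z : Site d) (i : Fin d), ‖(v (z + e i) : 𝔸) - v z‖ ≤ ω) (hωd : 300 * (d : ℝ) * ω ≤ 1)
    (k : ℕ) (hk : k ≤ d) :
    ∃ g : Site d → 𝔸ˣ,
      (∀ y, g y ∈ unitaryUnits 𝔸) ∧
      (∀ (y : Site d) (i : Fin d), g (y + ((M * N : ℕ) : ℤ) • e i) = g y) ∧
      (∀ z : Site d, g ((M : ℤ) • z) = v z) ∧
      (∀ (y : Site d) (κ : Fin d), k ≤ κ.val → g (y - res M y κ • e κ) = g y) ∧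
      (∀ (y : Site d) (κ : Fin d), k ≤ κ.val → ‖(g (y + (M : ℤ) • e κ) : 𝔸) - g y‖ ≤ ω * (1 + 30 * ω * k)) ∧
      (∀ (y : Site d) (μ : Fin d), μ.val < k → ‖(g (y + e μ) : 𝔸) - g y‖ ≤ 7 * ω / M * (1 + 30 * ω * k)) ∧
      (∀ (y : Site d) (μ τ : Fin d), μ.val < k → τ.val < k →
        ‖(g (y + e μ + e τ) : 𝔸) - g (y + e τ) - g (y + e μ) + g y‖ ≤ 110 * ω / (M : ℝ) ^ 2 * (1 + 150 * ω * k)) := by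
  induction k with
  | zero =>
    -- the pullback `y ↦ v ⌊y/M⌋`
    refine ⟨fun y => v (blk M y), fun y => hvU _, fun y i => ?_, fun z => ?_, fun y κ _ => ?_, fun y κ _ => ?_,
      fun y μ h => absurd h (Nat.not_lt_zero _), fun y μ τ h => absurd h (Nat.not_lt_zero _)⟩
    · have hc : ((M * N : ℕ) : ℤ) = (M : ℤ) * N := by push_cast; ring
      show v (blk M (y + ((M * N : ℕ) : ℤ) • e i)) = v (blk M y)
      rw [hc, (blk_res_add_period hM y N i).1, hvP]
    · show v (blk M ((M : ℤ) • z)) = v z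
      rw [(blk_res_smul hM z).1]
    · show v (blk M (y - res M y κ • e κ)) = v (blk M y)
      rw [(blk_res_floor hM y κ).1]
    · show ‖(v (blk M (y + (M : ℤ) • e κ)) : 𝔸) - v (blk M y)‖ ≤ ω * (1 + 30 * ω * (0 : ℕ))
      have h := (blk_res_add_period hM y 1 κ).1
      rw [mul_one, one_smul] at h
      rw [h]
      simpa using hvω (blk M y) κ
  | succ k ih =>
    obtain ⟨g, hgU, hgP, hgc, hpwc, hgΩ, hgl, hgσ⟩ := ih (by omega)
    have hkd : k < d := by omega
    obtain ⟨j, hj⟩ : ∃ j : Fin d, j = ⟨k, hkd⟩ := ⟨_, rfl⟩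
    have hjv : j.val = k := by rw [hj]
    -- numerics of the invariant
    have hω0 : 0 ≤ ω := (norm_nonneg _).trans (hvω 0 j)
    have hkd' : (k : ℝ) ≤ d := by exact_mod_cast hkd.le
    have hd1 : (1 : ℝ) ≤ d := by exact_mod_cast (by omega : 1 ≤ d)
    have hω300 : ω ≤ 1 / 300 := by nlinarith
    have hωk : 30 * ω * k ≤ 1 / 10 := by nlinarith [mul_nonneg hω0 (Nat.cast_nonneg k)]
    have hωk' : 150 * ω * k ≤ 1 / 2 := by nlinarith [mul_nonneg hω0 (Nat.cast_nonneg k)]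
    obtain ⟨Ω, hΩdef⟩ : ∃ Ω : ℝ, Ω = ω * (1 + 30 * ω * k) := ⟨_, rfl⟩
    obtain ⟨Lam, hLdef⟩ : ∃ Lam : ℝ, Lam = 7 * ω / M * (1 + 30 * ω * k) := ⟨_, rfl⟩
    obtain ⟨Sg, hSdef⟩ : ∃ Sg : ℝ, Sg = 110 * ω / (M : ℝ) ^ 2 * (1 + 150 * ω * k) := ⟨_, rfl⟩
    simp only [← hΩdef] at hgΩ
    simp only [← hLdef] at hgl
    simp only [← hSdef] at hgσ
    have hM0 : (0 : ℝ) < M := by exact_mod_cast hM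
    have hΩ0 : 0 ≤ Ω := by rw [hΩdef]; positivity
    have hΩω : Ω ≤ 11 / 10 * ω := by rw [hΩdef]; nlinarith
    have hΩ4 : Ω ≤ 1 / 4 := by linarith
    have hL0 : 0 ≤ Lam := by rw [hLdef]; positivity
    have hLω : Lam ≤ 77 / 10 * ω / M := by
      calc Lam = 7 * ω / M * (1 + 30 * ω * k) := hLdef
        _ ≤ 7 * ω / M * (11 / 10) := by gcongr; linarith
        _ = 77 / 10 * ω / M := by ring
    have hS0 : 0 ≤ Sg := by rw [hSdef]; positivity
    have hSω : Sg ≤ 165 * ω / (M : ℝ) ^ 2 := by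
      calc Sg = 110 * ω / (M : ℝ) ^ 2 * (1 + 150 * ω * k) := hSdef
        _ ≤ 110 * ω / (M : ℝ) ^ 2 * (3 / 2) := by gcongr; linarith
        _ = 165 * ω / (M : ℝ) ^ 2 := by ring
    -- the targets of the new invariant
    have hk1 : ((k + 1 : ℕ) : ℝ) = k + 1 := by push_cast; ring
    have hΩ' : (1 + 24 * Ω) * Ω ≤ ω * (1 + 30 * ω * ((k + 1 : ℕ) : ℝ)) := by
      have h1 : (1 + 24 * Ω) * Ω = Ω + 24 * (Ω * Ω) := by ring
      have h2 : Ω * Ω ≤ (11 / 10 * ω) * (11 / 10 * ω) := mul_le_mul hΩω hΩω hΩ0 (by positivity)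
      have h3 : ω * (1 + 30 * ω * ((k + 1 : ℕ) : ℝ)) = Ω + 30 * (ω * ω) := by rw [hk1, hΩdef]; ring
      rw [h1, h3]; nlinarith [mul_nonneg hω0 hω0]
    have hL' : (1 + 24 * Ω) * Lam ≤ 7 * ω / M * (1 + 30 * ω * ((k + 1 : ℕ) : ℝ)) := by
      have h1 : 7 * ω / M * (1 + 30 * ω * ((k + 1 : ℕ) : ℝ)) = Lam + 7 * ω / M * (30 * ω) := by rw [hk1, hLdef]; ring
      have h2 : (1 + 24 * Ω) * Lam = Lam + 24 * Ω * Lam := by ring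
      have h3 : 24 * Ω * Lam ≤ 24 * (11 / 10 * ω) * (77 / 10 * ω / M) := by gcongr
      have h4 : 24 * (11 / 10 * ω) * (77 / 10 * ω / M) ≤ 7 * ω / M * (30 * ω) := by
        rw [show 24 * (11 / 10 * ω) * (77 / 10 * ω / M) = 7 * ω / M * (2904 / 100 * ω) by ring]
        gcongr; norm_num
      rw [h1, h2]; linarith
    have hL'' : 6 * Ω / M ≤ 7 * ω / M * (1 + 30 * ω * ((k + 1 : ℕ) : ℝ)) := by
      have h1 : 6 * Ω / M ≤ 6 * (11 / 10 * ω) / M := by gcongr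
      have h2 : (1 : ℝ) ≤ 1 + 30 * ω * ((k + 1 : ℕ) : ℝ) := by
        have : 0 ≤ 30 * ω * ((k + 1 : ℕ) : ℝ) := by positivity
        linarith
      calc 6 * Ω / M ≤ 6 * (11 / 10 * ω) / M := h1
        _ = 66 / 10 * ω / M * 1 := by ring
        _ ≤ 7 * ω / M * (1 + 30 * ω * ((k + 1 : ℕ) : ℝ)) := by gcongr; norm_num
    have hk0 : (1 : ℝ) ≤ 1 + 150 * ω * ((k + 1 : ℕ) : ℝ) := by
      have : 0 ≤ 150 * ω * ((k + 1 : ℕ) : ℝ) := by positivity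
      linarith
    have hgoal : Sg + 53 * Ω * Sg + 115 * (Lam * Lam) ≤ 110 * ω / (M : ℝ) ^ 2 * (1 + 150 * ω * ((k + 1 : ℕ) : ℝ)) := by
      have e1 : 110 * ω / (M : ℝ) ^ 2 * (1 + 150 * ω * ((k + 1 : ℕ) : ℝ)) = Sg + 16500 * (ω * ω) / (M : ℝ) ^ 2 := by
        rw [hk1, hSdef]; ring
      have h53 : 53 * Ω * Sg ≤ 53 * (11 / 10 * ω) * (165 * ω / (M : ℝ) ^ 2) := by gcongr
      have h115 : 115 * (Lam * Lam) ≤ 115 * ((77 / 10 * ω / M) * (77 / 10 * ω / M)) := by gcongr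
      have e2 : 53 * (11 / 10 * ω) * (165 * ω / (M : ℝ) ^ 2) + 115 * ((77 / 10 * ω / M) * (77 / 10 * ω / M))
          = 1643785 / 100 * (ω * ω) / (M : ℝ) ^ 2 := by ring
      have h3 : 1643785 / 100 * (ω * ω) / (M : ℝ) ^ 2 ≤ 16500 * (ω * ω) / (M : ℝ) ^ 2 := by
        gcongr; norm_num
      rw [e1]; linarith
    have hmixed : 3 / 2 / (M : ℝ) * Lam * (4 * Ω * (1 + 24 * Ω) + 8) ≤ 110 * ω / (M : ℝ) ^ 2 * (1 + 150 * ω * ((k + 1 : ℕ) : ℝ)) := by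
      have hsmall : 4 * Ω * (1 + 24 * Ω) ≤ 1 := by nlinarith
      calc 3 / 2 / (M : ℝ) * Lam * (4 * Ω * (1 + 24 * Ω) + 8) ≤ 3 / 2 / (M : ℝ) * (77 / 10 * ω / M) * (1 + 8) := by
            gcongr
        _ = 10395 / 100 * ω / (M : ℝ) ^ 2 * 1 := by ring
        _ ≤ 110 * ω / (M : ℝ) ^ 2 * (1 + 150 * ω * ((k + 1 : ℕ) : ℝ)) := by gcongr; norm_num
    have hjj : 24 * Ω / (M : ℝ) ^ 2 + 36 * Ω ^ 2 / (M : ℝ) ^ 2 ≤ 110 * ω / (M : ℝ) ^ 2 * (1 + 150 * ω * ((k + 1 : ℕ) : ℝ)) := by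
      have h1 : Ω ^ 2 ≤ Ω * (1 / 4) := by rw [sq]; exact mul_le_mul_of_nonneg_left hΩ4 hΩ0
      have h2 : 24 * Ω + 36 * Ω ^ 2 ≤ 110 * ω := by linarith
      calc 24 * Ω / (M : ℝ) ^ 2 + 36 * Ω ^ 2 / (M : ℝ) ^ 2 = (24 * Ω + 36 * Ω ^ 2) / (M : ℝ) ^ 2 := by ring
        _ ≤ 110 * ω / (M : ℝ) ^ 2 * 1 := by rw [mul_one]; gcongr
        _ ≤ 110 * ω / (M : ℝ) ^ 2 * (1 + 150 * ω * ((k + 1 : ℕ) : ℝ)) := by gcongr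
    -- the step in direction `j = k`
    have hgΩj : ∀ y, ‖(g (y + (M : ℤ) • e j) : 𝔸) - g y‖ ≤ Ω := fun y => hgΩ y j (by rw [hjv])
    obtain ⟨g', hdef⟩ : ∃ g' : Site d → 𝔸ˣ, ∀ y : Site d,
        g' y = geo (3 * (((res M y j : ℤ) : ℝ) / M) ^ 2 - 2 * (((res M y j : ℤ) : ℝ) / M) ^ 3)
          (g (y - res M y j • e j)) (g (y - res M y j • e j + (M : ℤ) • e j)) := ⟨_, fun y => rfl⟩
    refine ⟨g', fun y => step_unitary hgU hgΩj hΩ4 hdef y, fun y i => step_periodic hM N hgP hdef y i,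
      fun z => (step_corner hM hdef z).trans (hgc z), fun y κ hκ => ?_, fun y κ hκ => ?_, fun y μ hμ => ?_,
      fun y μ τ hμ hτ => ?_⟩
    · -- piecewise constancy in the directions `≥ k + 1`
      have hne : κ ≠ j := fun h => by rw [h, hjv] at hκ; omega
      exact step_pwc hM hne (fun y => hpwc y κ (by omega)) hdef y
    · -- coarse oscillation in the directions `≥ k + 1`
      obtain ⟨hres, hfl⟩ := coarse_step_keeps (d := d) hM κ (j := j)
      exact (step_shift_first hM hgU hgΩj hΩ4 hdef hres hfl (fun y => hgΩ y κ (by omega)) y).trans hΩ'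
    · -- first differences in the directions `< k + 1`
      by_cases hμj : μ = j
      · rw [hμj]
        exact (step_dir_first hM hgU hgΩj hΩ4 hdef y).trans hL''
      · have hμk : μ.val < k := by
          have : μ.val ≠ k := fun h => hμj (Fin.ext (by rw [hjv]; exact h))
          omega
        obtain ⟨hres, hfl⟩ := unit_step_keeps (d := d) hM hμj
        exact (step_shift_first hM hgU hgΩj hΩ4 hdef hres hfl (fun y => hgl y μ hμk) y).trans hL'
    · -- second differences in the directions `< k + 1`
      by_cases hμj : μ = j
      · by_cases hτj : τ = j
        · rw [hμj, hτj]
          exact (step_dir_second hM hgU hgΩj hΩ4 hdef y).trans hjj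
        · rw [hμj]
          have hτk : τ.val < k := by
            have : τ.val ≠ k := fun h => hτj (Fin.ext (by rw [hjv]; exact h))
            omega
          exact (step_mixed_second hM hgU hgΩj hΩ4 hdef hτj (fun y => hgl y τ hτk) y).trans hmixed
      · by_cases hτj : τ = j
        · rw [hτj]
          have hμk : μ.val < k := by
            have : μ.val ≠ k := fun h => hμj (Fin.ext (by rw [hjv]; exact h))
            omega
          have hsym : ((g' (y + e μ + e j) : 𝔸) - g' (y + e j) - g' (y + e μ) + g' y
              = (g' (y + e j + e μ) : 𝔸) - g' (y + e μ) - g' (y + e j) + g' y) := by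
            rw [add_right_comm y (e μ) (e j)]; abel
          rw [hsym]
          exact (step_mixed_second hM hgU hgΩj hΩ4 hdef hμj (fun y => hgl y μ hμk) y).trans hmixed
        · have hμk : μ.val < k := by
            have : μ.val ≠ k := fun h => hμj (Fin.ext (by rw [hjv]; exact h))
            omega
          have hτk : τ.val < k := by
            have : τ.val ≠ k := fun h => hτj (Fin.ext (by rw [hjv]; exact h))
            omega
          exact (step_kept_second hM hgU hgΩj hΩ4 hdef hμj hτj (fun y => hgl y μ hμk) (fun y => hgl y τ hτk)
            (fun y => hgσ y μ τ hμk hτk) y).trans hgoal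

/-! ## §2 The corner-gauge interpolation theorem -/

/-- **THE C² CORNER-GAUGE INTERPOLATION.**  Let `v : ℤ^d → U(𝔸)` be unitary, `N`-periodic, with nearest-neighbour oscillation
`‖v(z + e_i) − v z‖ ≤ ω`, `300·d·ω ≤ 1`, and let `M ≥ 1`.  Then there is a unitary, `M·N`-periodic `w : ℤ^d → U(𝔸)` with
`w (M•z) = v z` whose first lattice differences are `≤ 8ω∕M` and whose second lattice differences (all pairs of directions)
are `≤ 165ω∕M²`.  (For the END: `v z = u₀(Mz)⁻¹·c` makes `(w·u₀)|_{corners}` constant, i.e. `hflatTop` for the re-gauged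
representative — bookkeeping not done here.) [folklore] -/
theorem exists_smooth_corner_gauge (hM : 1 ≤ M) (N : ℕ) {v : Site d → 𝔸ˣ} (hvU : ∀ z, v z ∈ unitaryUnits 𝔸)
    (hvP : ∀ (z : Site d) (i : Fin d), v (z + (N : ℤ) • e i) = v z) {ω : ℝ}
    (hvω : ∀ (z : Site d) (i : Fin d), ‖(v (z + e i) : 𝔸) - v z‖ ≤ ω) (hωd : 300 * (d : ℝ) * ω ≤ 1) :
    ∃ w : Site d → 𝔸ˣ,
      (∀ y, w y ∈ unitaryUnits 𝔸) ∧
      (∀ (y : Site d) (i : Fin d), w (y + ((M * N : ℕ) : ℤ) • e i) = w y) ∧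
      (∀ z : Site d, w ((M : ℤ) • z) = v z) ∧
      (∀ (y : Site d) (μ : Fin d), ‖(w (y + e μ) : 𝔸) - w y‖ ≤ 8 * ω / M) ∧
      (∀ (y : Site d) (μ τ : Fin d), ‖(w (y + e μ + e τ) : 𝔸) - w (y + e τ) - w (y + e μ) + w y‖ ≤ 165 * ω / (M : ℝ) ^ 2) := by
  obtain ⟨w, hwU, hwP, hwc, -, -, hwl, hwσ⟩ := iterate hM N hvU hvP hvω hωd d le_rfl
  refine ⟨w, hwU, hwP, hwc, fun y μ => ?_, fun y μ τ => ?_⟩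
  · have hω0 : 0 ≤ ω := (norm_nonneg _).trans (hvω 0 μ)
    have hM0 : (0 : ℝ) < M := by exact_mod_cast hM
    refine (hwl y μ μ.isLt).trans ?_
    have : 30 * ω * (d : ℝ) ≤ 1 / 10 := by nlinarith [mul_nonneg hω0 (Nat.cast_nonneg d)]
    rw [div_mul_eq_mul_div, div_le_div_iff_of_pos_right hM0]
    nlinarith [mul_nonneg hω0 (mul_nonneg hω0 (Nat.cast_nonneg d))]
  · have hω0 : 0 ≤ ω := (norm_nonneg _).trans (hvω 0 μ)
    have hM0' : (0 : ℝ) < M := by exact_mod_cast hM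
    have hM0 : (0 : ℝ) < (M : ℝ) ^ 2 := by positivity
    refine (hwσ y μ τ μ.isLt τ.isLt).trans ?_
    have : 150 * ω * (d : ℝ) ≤ 1 / 2 := by nlinarith [mul_nonneg hω0 (Nat.cast_nonneg d)]
    rw [div_mul_eq_mul_div, div_le_div_iff_of_pos_right hM0]
    nlinarith [mul_nonneg hω0 (mul_nonneg hω0 (Nat.cast_nonneg d))]

end

end Summit.QuantumFields.BalabanUV.T4Continuum.NE7CornerGaugeInterpolation
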